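import Summits.NavierStokesRegularity.OSWSelfSimilar.SheetNSLineTorusCascade
import HarnessLib

/-!
# Viscous CLM on the torus (`a = 0`, `σ = 2`): the SUPER-SOLUTION COMPARISON PRINCIPLE for the sine-datum cascade
# (tail majorant from an index `k₀` on, head modes kept exact) — the logical skeleton of the certified lower bound on the threshold

HONEST FRAMING (cell ns-blowup GROUP B «PROFILE SEARCH», zone Z3, row Z3-U addendum A-F2; human rulings D-0035/D-0074; Z3-TWIN
lineage): **1-D MODEL (viscous Constantin–Lax–Majda equation on `𝕋`); ODE comparison on Fourier-coefficient families, kernel-checked;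
not Euler, not Navier–Stokes; «violates: none — MODEL».**

OBJECT: the sine-datum cascade `IsSineCascade ν c e` of `SheetNSLineTorusCascade` (`ċ_k = ½ Σ_{i+j=k} c_i c_j − ν k² c_k`,
`c_1(0) = c ≥ 0`, `c_k(0) = 0` for `k ≥ 2`; all `c_k ≥ 0` by `nonneg`). The two concrete majorants already in the tree
(`mode_le_sigmaOne`: the `σ = 1` profile; `mode_le_pole8`: the receding pole of amplitude `8`) are instances of ONE principle,
typed here abstractly so that a CERTIFICATE can supply the majorant:

* `le_of_supersolution` — **comparison principle.** Fix `k₀ ≥ 2` and functions `U_k` (`k ≥ k₀`) continuous on `[0, ∞)`,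
  differentiable on `(0, ∞)` with derivative `U′_k`, `U_k(0) ≥ 0`, satisfying for every `k ≥ k₀` and `t > 0` the super-solution
  inequality `½ Σ_{i+j=k} V_i V_j ≤ U′_k + ν k² U_k`, where `V_i := c_i` (the solution itself) for `i < k₀` and `V_i := U_i` for
  `i ≥ k₀`. THEN `c_k(t) ≤ U_k(t)` for all `k ≥ k₀`, `t ≥ 0`. (Strong induction; `e^{νk²t}(U_k − c_k)` is non-decreasing because
  `0 ≤ c_i ≤ V_i` termwise.)
* `le_const_of_pointwise_sup` — **the constant-tail form used by the certificate**: if `u_k ≥ 0` (`k ≥ k₀`) and for every `k ≥ k₀`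
  and `t > 0` there is a head table `H` with `c_i(t) ≤ H_i` (`i < k₀`) and `½ Σ_{i+j=k} Ĥ_i Ĥ_j ≤ ν k² u_k` (`Ĥ_i = H_i` for
  `i < k₀`, `u_i` for `i ≥ k₀`), then `c_k(t) ≤ u_k` for all `k ≥ k₀`, `t ≥ 0`. A certificate meets the hypothesis by covering
  `(0, ∞)` with finitely many time-windows and taking `H` = rigorous window sups of the (exactly known) head modes.
READING (what the certificate adds outside the kernel, `HOME/profile/z3twin/runs/Z3-cascade-CERT_j271042/`): with `k₀ = 65`,
`u_k = 12 k μ₀^k`, `μ₀ = (1 + 10⁻⁶)/19.775567578656` (ν = 1 units) the window inequalities hold (64 exact head modes, interval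
Taylor bounds with directed rounding, exact-rational re-check), whence the analyticity radius of `Σ c_k w^k` is `≥ 1/μ₀` for all
times: global regularity for sine data with `|ω₀|_∞ < 19.7755478 ν` — the MODEL's located threshold being `19.7755676 ν`.
bears_on: LADDER-NS N5 / zone Z3 (row Z3-U) → N1 linear core. WHAT THIS IS NOT: not NS; no number is certified by THIS file (it is
the comparison skeleton only); no definitions.
-/

namespace Summit.NavierStokesRegularity.OSWSelfSimilar
namespace SheetNSLineTorusCascade

open Finset Real Set

variable {ν c : ℝ} {e : ℕ → ℝ → ℝ}

/-- **SUPER-SOLUTION COMPARISON PRINCIPLE** for the sine-datum cascade (head exact, tail majorant from `k₀ ≥ 2` on): if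
`U_k` (`k ≥ k₀`) are continuous on `[0,∞)`, have derivative `U′_k t` at every `t > 0`, start at `U_k(0) ≥ 0`, and satisfy
`½ Σ_{i+j=k} V_i(t) V_j(t) ≤ U′_k(t) + ν k² U_k(t)` for `t > 0` with `V_i = c_i` (`i < k₀`), `V_i = U_i` (`i ≥ k₀`), then
`c_k(t) ≤ U_k(t)` for every `k ≥ k₀` and `t ≥ 0`. [new here — MODEL] -/
theorem le_of_supersolution (he : IsSineCascade ν c e) (hc : 0 ≤ c) {k₀ : ℕ} (hk₀ : 2 ≤ k₀)
    (U U' : ℕ → ℝ → ℝ)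
    (hcont : ∀ k, k₀ ≤ k → ContinuousOn (U k) (Ici 0))
    (hderiv : ∀ k, k₀ ≤ k → ∀ t, 0 < t → HasDerivAt (U k) (U' k t) t)
    (hinit : ∀ k, k₀ ≤ k → 0 ≤ U k 0)
    (hsuper : ∀ k, k₀ ≤ k → ∀ t, 0 < t →
      (1 / 2) * ∑ p ∈ antidiagonal k,
          (if p.1 < k₀ then e p.1 t else U p.1 t) * (if p.2 < k₀ then e p.2 t else U p.2 t)
        ≤ U' k t + ν * (k : ℝ) ^ 2 * U k t) :
    ∀ k, k₀ ≤ k → ∀ t, 0 ≤ t → e k t ≤ U k t := by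
  intro k
  induction k using Nat.strong_induction_on with
  | _ k ih =>
    intro hk t ht
    -- termwise domination of the convolution at times s > 0
    have hconv : ∀ s, 0 < s →
        ∑ p ∈ antidiagonal k, e p.1 s * e p.2 s
          ≤ ∑ p ∈ antidiagonal k,
              (if p.1 < k₀ then e p.1 s else U p.1 s) * (if p.2 < k₀ then e p.2 s else U p.2 s) := by
      intro s hs
      refine sum_le_sum fun p hp => ?_
      have hsum : p.1 + p.2 = k := mem_antidiagonal.mp hp
      have hs0 : 0 ≤ s := le_of_lt hs
      -- each factor: 0 ≤ e_i s ≤ V_i s (for i < k; the cases i = 0 or i = k are handled by e_0 = 0)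
      have hV : ∀ i, i < k → 0 ≤ e i s ∧ e i s ≤ (if i < k₀ then e i s else U i s) := by
        intro i hi
        refine ⟨nonneg he hc i s hs0, ?_⟩
        by_cases hik : i < k₀
        · rw [if_pos hik]
        · rw [if_neg hik]
          exact ih i hi (Nat.le_of_not_lt hik) s hs0
      rcases Nat.eq_zero_or_pos p.1 with h1 | h1
      · have hk0 : (0 : ℕ) < k₀ := by omega
        rw [h1, he.zero, zero_mul, if_pos hk0, zero_mul]
      rcases Nat.eq_zero_or_pos p.2 with h2 | h2
      · have hk0 : (0 : ℕ) < k₀ := by omega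
        rw [h2, he.zero, mul_zero, if_pos hk0, mul_zero]
      obtain ⟨ha0, ha⟩ := hV p.1 (by omega)
      obtain ⟨hb0, hb⟩ := hV p.2 (by omega)
      exact mul_le_mul ha hb hb0 (le_trans ha0 ha)
    -- ψ(s) = e^{νk²s} (U_k s − e_k s) is non-decreasing on [0, ∞)
    set D : ℝ → ℝ := fun s => exp (ν * (k : ℝ) ^ 2 * s) * e k s with hD
    set W : ℝ → ℝ := fun s => exp (ν * (k : ℝ) ^ 2 * s) * U k s with hW
    have hW' : ∀ s, 0 < s → HasDerivAt W
        (exp (ν * (k : ℝ) ^ 2 * s) * (ν * (k : ℝ) ^ 2) * U k s + exp (ν * (k : ℝ) ^ 2 * s) * U' k s) s := by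
      intro s hs
      have h1 : HasDerivAt (fun s => exp (ν * (k : ℝ) ^ 2 * s)) (exp (ν * (k : ℝ) ^ 2 * s) * (ν * (k : ℝ) ^ 2)) s := by
        have := ((hasDerivAt_id s).const_mul (ν * (k : ℝ) ^ 2)).exp
        simpa using this
      exact h1.mul (hderiv k hk s hs)
    have hmono : MonotoneOn (fun s => W s - D s) (Ici 0) := by
      refine monotoneOn_of_hasDerivWithinAt_nonneg
        (f' := fun s => (exp (ν * (k : ℝ) ^ 2 * s) * (ν * (k : ℝ) ^ 2) * U k s + exp (ν * (k : ℝ) ^ 2 * s) * U' k s)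
          - exp (ν * (k : ℝ) ^ 2 * s) * ((1 / 2) * ∑ p ∈ antidiagonal k, e p.1 s * e p.2 s))
        (convex_Ici 0) ?_ (fun s hs => ?_) (fun s hs => ?_)
      · exact ContinuousOn.sub
          (((continuous_exp.comp (continuous_const.mul continuous_id)).continuousOn).mul (hcont k hk))
          (continuousOn_weighted he k)
      · rw [interior_Ici] at hs ⊢
        exact ((hW' s hs).sub (hasDerivAt_weighted he k hs)).hasDerivWithinAt
      · rw [interior_Ici] at hs
        have hE : 0 ≤ exp (ν * (k : ℝ) ^ 2 * s) := (exp_pos _).le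
        have h1 : exp (ν * (k : ℝ) ^ 2 * s) * ((1 / 2) * ∑ p ∈ antidiagonal k, e p.1 s * e p.2 s)
            ≤ exp (ν * (k : ℝ) ^ 2 * s) * (U' k s + ν * (k : ℝ) ^ 2 * U k s) := by
          refine mul_le_mul_of_nonneg_left (le_trans ?_ (hsuper k hk s hs)) hE
          exact mul_le_mul_of_nonneg_left (hconv s hs) (by norm_num)
        have h2 : exp (ν * (k : ℝ) ^ 2 * s) * (U' k s + ν * (k : ℝ) ^ 2 * U k s)
            = exp (ν * (k : ℝ) ^ 2 * s) * (ν * (k : ℝ) ^ 2) * U k s + exp (ν * (k : ℝ) ^ 2 * s) * U' k s := by ring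
        linarith
    -- evaluate at 0: W 0 − D 0 = U_k 0 − e_k 0 = U_k 0 ≥ 0
    have hk2 : 2 ≤ k := le_trans hk₀ hk
    have hD0 : D 0 = 0 := by simp [hD, he.init_zero k hk2]
    have hW0 : 0 ≤ W 0 := by simpa [hW] using hinit k hk
    have hψ := hmono (Set.self_mem_Ici) (show t ∈ Set.Ici (0:ℝ) from ht) ht
    simp only [hD0, sub_zero] at hψ
    have hWD : D t ≤ W t := by linarith
    have hineq : exp (ν * (k : ℝ) ^ 2 * t) * e k t ≤ exp (ν * (k : ℝ) ^ 2 * t) * U k t := by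
      simpa [hD, hW] using hWD
    exact le_of_mul_le_mul_left hineq (exp_pos _)

/-- **THE CONSTANT-TAIL FORM (what a window certificate verifies).** Let `k₀ ≥ 2` and constants `u_k ≥ 0` (`k ≥ k₀`). Suppose that
for every `k ≥ k₀` and every `t > 0` there is a head table `H : ℕ → ℝ` with `c_i(t) ≤ H_i` for `i < k₀` and
`½ Σ_{i+j=k} Ĥ_i Ĥ_j ≤ ν k² u_k`, `Ĥ_i := H_i` (`i < k₀`), `Ĥ_i := u_i` (`i ≥ k₀`). Then `c_k(t) ≤ u_k` for all `k ≥ k₀`, `t ≥ 0` —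
in particular the analyticity radius of `Σ_k c_k(t) w^k` is at least `1/limsup u_k^{1/k}` at ALL times. (A certificate covers
`(0,∞)` by finitely many windows and takes `H` = rigorous window sups of the exactly known head modes.) [new here — MODEL] -/
theorem le_const_of_pointwise_sup (he : IsSineCascade ν c e) (hc : 0 ≤ c) {k₀ : ℕ} (hk₀ : 2 ≤ k₀)
    (u : ℕ → ℝ) (hu : ∀ k, k₀ ≤ k → 0 ≤ u k)
    (hwin : ∀ k, k₀ ≤ k → ∀ t, 0 < t → ∃ H : ℕ → ℝ,
      (∀ i, i < k₀ → e i t ≤ H i) ∧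
      (1 / 2) * ∑ p ∈ antidiagonal k,
          (if p.1 < k₀ then H p.1 else u p.1) * (if p.2 < k₀ then H p.2 else u p.2)
        ≤ ν * (k : ℝ) ^ 2 * u k) :
    ∀ k, k₀ ≤ k → ∀ t, 0 ≤ t → e k t ≤ u k := by
  -- apply the comparison principle with the constant family U_k(t) = u_k, U′ = 0
  have key := le_of_supersolution he hc hk₀ (fun k _ => u k) (fun _ _ => 0)
    (fun k _ => continuousOn_const) (fun k _ t _ => hasDerivAt_const t (u k)) (fun k hk => hu k hk) ?_
  · intro k hk t ht
    exact key k hk t ht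
  · intro k hk t ht
    obtain ⟨H, hH, hineq⟩ := hwin k hk t ht
    rw [zero_add]
    refine le_trans ?_ hineq
    refine mul_le_mul_of_nonneg_left (sum_le_sum fun p hp => ?_) (by norm_num)
    have hsum : p.1 + p.2 = k := mem_antidiagonal.mp hp
    have ht0 : 0 ≤ t := le_of_lt ht
    -- each factor: 0 ≤ (e or u) ≤ (H or u)
    have hfac : ∀ i, i < k ∨ k₀ ≤ i →
        0 ≤ (if i < k₀ then e i t else u i) ∧
          (if i < k₀ then e i t else u i) ≤ (if i < k₀ then H i else u i) := by
      intro i hi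
      by_cases hik : i < k₀
      · rw [if_pos hik, if_pos hik]
        exact ⟨nonneg he hc i t ht0, hH i hik⟩
      · rw [if_neg hik, if_neg hik]
        exact ⟨hu i (Nat.le_of_not_lt hik), le_rfl⟩
    have h1 : p.1 < k ∨ k₀ ≤ p.1 := by
      by_cases hp1 : p.1 < k
      · exact Or.inl hp1
      · exact Or.inr (by omega)
    have h2 : p.2 < k ∨ k₀ ≤ p.2 := by
      by_cases hp2 : p.2 < k
      · exact Or.inl hp2
      · exact Or.inr (by omega)
    obtain ⟨ha0, ha⟩ := hfac p.1 h1
    obtain ⟨hb0, hb⟩ := hfac p.2 h2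
    exact mul_le_mul ha hb hb0 (le_trans ha0 ha)

end SheetNSLineTorusCascade
end Summit.NavierStokesRegularity.OSWSelfSimilar
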